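import Summits.HodgeConjecture.HodgeConjecture.Theorems.F0P6aPELSpreadDefs
import Summits.HodgeConjecture.HodgeConjecture.Theorems.F0P6aEReadings
import Summits.HodgeConjecture.HodgeConjecture.Theorems.F0P6aFrobKernelBanalAtCanonicalTwistIdeal
import Summits.HodgeConjecture.HodgeConjecture.Theorems.F0P6aEExports
import Literature.FieldTheory.Galois.GaloisCompositumInComplex
import Literature.AlgebraicGeometry.Motives.IntegralModelRestrictScalarsSheetsThickening
import Literature.AlgebraicGeometry.Limits.IntermediateFlatModel
import Literature.NumberTheory.Automorphic.UnitaryGroupHyperspecialHecke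
import Literature.NumberTheory.Automorphic.UnitaryGroupLocalFactors
import HarnessLib
import HarnessLib.Audit.LibrarySuggestionsDenyListCruxes

/-!
# `F0P6aStubGEN` — ★ TWIN (K6 P∕E column wave E4, LEAD F0P6-plan «M-142a» (B) + RULING «M-145e» (ρ1)∕(ρ2); RE-HOME TABLE v1.7 (LA7-plan (g7)), canonical header «M-142a» (A), carrier «M-142d» «P-κ») of the GEN closer leaf `Lines/F0_P6a_StubGEN.lean` ED. 2

**SIZE-LINT SPLIT ×2** (`Theorems/` files with proofs are ≤ 400 lines): parts `Theorems/F0P6aStubGENZip.lean` → `Theorems/F0P6aStubGEN.lean`, each importing the previous, cut at declaration boundaries of `Lines/F0_P6a_StubGEN.lean`; namespaces AND sections KEPT and re-opened per part (with their `open`∕`variable` lines replayed verbatim); the options preamble is repeated. This is PART 1.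

This `Theorems/` module is the TREE BYTES of `Summits/HodgeConjecture/HodgeConjecture/Cruxes/HLiu418/Lines/F0_P6a_StubGEN.lean` (tree sha16 90d9fb611acd841e, 505 l.; sorry-free, stub-free = class B of RE-HOME TABLE v1.7)
re-homed VERBATIM with the NAMESPACE KEPT (`Summit.HodgeConjecture.HodgeConjecture.Cruxes.HLiu418.F0P6aStubGEN`), so every fully-qualified name of its 12 declarations is UNCHANGED
(0 FQN moves, 0 downstream bytes, 0 statement bytes).  The only edits are (a) this re-headed module docstring, (b) the `Lines` imports switched to their ★ homes (l.1 `Lines.F0_P6a_PELSpread` → `Theorems.F0P6aPELSpreadDefs`; l.2 `Lines.F0_P6a_EReadings` → `Theorems.F0P6aEReadings`; l.4 `Lines.F0_P6a_EExports` → `Theorems.F0P6aEExports`),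
and (c) on the docstrings of the header-CLOSED `def … : Prop` letters (`RecordGENChoicesCofinal`, `RecordHeckeZip`, `RecordTwistZip`) the locator tokens are spelled `(print: …)` instead of `[cite: …]` — same locators, same prose — because a `[cite:]`-tagged closed Prop in a `Theorems/` proposal is
RELOCATED to `Literature/` by the gate («STATE IT INLINE» rule; observed p852785∕p852786, LA-ref1 (g5) BOX K5 #R1), which would MOVE the FQN; these Props are statement
ABBREVIATIONS of our own sockets, not printed facts (precedent ★ `Theorems/F0P6aModuliDatumDefs.lean` `RecordModuliDatumCofinal` `(print:)` ×5).

Why: E-column parents-first — this closer imports the E-READINGS (★ E1) and the X-leaf (★ E3) and is imported by MAIN; its tree original imports the `Lines/F0_P6a_PELSpread` HUB (sockets `stub_GSPREAD`∕`stub_ELAWS`),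
which a `Theorems/` file may not (gate import fence), so (ρ1) the twin imports ★ `F0P6aPELSpreadDefs` instead and spells the head՚s type `elaws_of_line : …F0P6aPELSpread.RecordPELELawsCofinal` — ONE token for tree :497
`type_of% @…F0P6aPELSpread.stub_ELAWS` (the hub declares `stub_ELAWS : RecordPELELawsCofinal` over that ★ constant, namespace kept ⇒ elaborated statement IDENTICAL); (ρ2) the same-statement tie tree :501
`example : @…stub_ELAWS = @elaws_of_line := rfl` is NOT twinned — it moves hub-side into the `Lines/F0_P6a_StubGEN.lean` SHIM edition (imports the hub + this module).  Every other byte verbatim.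
(ρ3) it unlocks: hub ED. 3 pays `stub_ELAWS := F0P6aStubGEN.elaws_of_line` by term (literal sorries 2 → 1).
HC_CM is proved only modulo the 7 printed citations (2 remaining: hLiu418 = stmt-HodgeConjecture-24832, h413 = stmt-HodgeConjecture-24833) until rung 0 closes; a re-home is count-neutral.

## Import provenance (header is CANONICAL: bare `import` lines, «M-142a» (A); the ROOT part carries `HarnessLib.Audit.LibrarySuggestionsDenyListCruxes`, «M-142d» «P-κ»)
- `Summits.HodgeConjecture.HodgeConjecture.Theorems.F0P6aPELSpreadDefs` — ★ K5 №6 p852937: the L4-leaf DEFS twin (letters `RecordPELELawsCofinal` …, `spread_of_parts`, `stub_INJ0`); NEVER the `Lines/F0_P6a_PELSpread` hub (LEAD «M-145e» (ρ1))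
- `Summits.HodgeConjecture.HodgeConjecture.Theorems.F0P6aEReadings` — ★ K6 E1 twin (LAST part)
- `Summits.HodgeConjecture.HodgeConjecture.Theorems.F0P6aFrobKernelBanalAtCanonicalTwistIdeal` — ★ p848302 (LA4-p04 (g0)): `frobKernelBanal_canTwistIdeal` — the row-(7) payer feed
- `Summits.HodgeConjecture.HodgeConjecture.Theorems.F0P6aEExports` — ★ K6 E3 twin of the X-leaf (LAST of 3 parts): `eLaws_of_frames`
- `Literature.FieldTheory.Galois.GaloisCompositumInComplex` — ★ p849484 `exists_numberField_isGalois_comp_eq` (slice-field compositum over `ι₁`)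
- `Literature.AlgebraicGeometry.Motives.IntegralModelRestrictScalarsSheetsThickening` — ★ `restrictScalarsOfIntermediate`, `sheetModelOf`, `eq_one_of_geomReductionMap_thickeningLift_eq`
- `Literature.AlgebraicGeometry.Limits.IntermediateFlatModel` — ★ p849537 `exists_intermediateModel` ((O-MODEL))
- `Literature.NumberTheory.Automorphic.UnitaryGroupHyperspecialHecke` — ★ `eventually_isHyperspecialAt`
- `Literature.NumberTheory.Automorphic.UnitaryGroupLocalFactors` — ★ `tendsto_placesOver_cofinite`
- `HarnessLib`

## Original module docstring (verbatim)
# `F0_P6a_StubGEN` — THE GEN CLOSER LEAF ABOVE THE L4 LEAF: `elaws_of_line : type_of% @F0P6aPELSpread.stub_ELAWS` (ED. 1 cand v1, GEN heir A-p18 (g32); desk F0P6a-plan (g4) SOCKET PLAN «P-SIDE AFTER M-66» (A1) 04:40:15Z; «L4» LA4-plan (g0) «=» 03:46:59Z ∕ assignment 04:34:59Z)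

CRUX `stmt-HodgeConjecture-24832` (HLiu418), sub-line P6a, line «L4».  SOCKET: the L4 closer leaf `Lines/F0_P6a_PELSpread.lean` ED. 1 (desk (g4), tree
4f143bbfae3e880b, (HI) BUILT 04:37:45Z) `stub_ELAWS : RecordPELELawsCofinal` (:291).  Desk plan (A) «closer leaves above + MAIN ED. 8 parametric»: this module is
(A1) — it imports the SERVED leaf, pays `stub_ELAWS` BY NAME through GEN՚s zip `elaws_of_parts` at ONE registered-by-write socket `stub_GEN` (GEN՚s choices in
E-currency) and two PAID transport organs, and is consumed one level up at MAIN ED. 8: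
`stub_RGD := rgd_of_inputs (F0P6aPELInputs.pel_of_inputs (F0P6aPELSpread.spread_of_parts ‹gspread› F0P6aPELSpread.stub_INJ0 F0P6aStubGEN.elaws_of_line) F0P6aPELInputs.stub_DUALS) (datum_of_inputs …)`.
Why this line: the leaf ED. 1 head `spread_of_parts (hG) (hI) (hL)` is PARAMETRIC, so `stub_ELAWS` is paid WITHOUT rewriting the leaf or the P-line (no letter moves home,
no duplicate `RecordPELELawsCofinal`); the E → P transports are theorems TODAY (E-READINGS ED. 2 + §0c + ★ p848302), so the only honest open cell on this branch is
GEN՚s choices + the E-line՚s exports in E-currency — ONE socket with a typed letter the E-pen can read.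

THE CUT (ED. 1; ONE socket, TRUE as typed):
* §1 LETTER `RecordGENChoicesCofinal` — `RecordPELELawsCofinal` TOKEN FOR TOKEN (GEN՚s block `Fᵢ Kc G φ 𝓜`, the FRAME FAMILY `ιdx Φf τE Ef`, a finite `S_G`; per good split
  `w ∉ S_G`: the hyperspecial passage, `∃ i, KottAdaptedAt ι₁ w (Φf i) ∧ UnmixedAt ι₁ w (Φf i) ∧ …`) with, IN PLACE OF the tail `∀ T : PELSpreadAt …, provenance → laws`, THE
  E-CURRENCY LAWS OF THE CHOSEN WITNESS `Ef i` AT `w`: `ESepAt S Kc w (Ef i)` and, for the arithmetic `(p, f)` of `w` universally guarded (`Nat.Prime p → (p : 𝓞 F) ∈ 𝔭_w →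
  N(𝔭_{c•w}) = p ^ f`; a spread instantiates at `T.pChar T.fDeg` by `T.hpChar.1 T.hpChar.2 T.hfDeg`), `EHeckeAt … (Ef i) p f ∧ ∀ e, ETwistKerAt S Kc w e (Ef i) p f`; then
  `hdisj` under `∀ h𝓨 θ hθ e`.  TRUE of the witnesses it chooses (never universal over a by-value `E`, n5).
* §2 LETTERS `RecordHeckeZip` ∕ `RecordTwistZip` — the by-value per-spread transports `∀ … T, EHeckeAt … T.E T.pChar T.fDeg → PELHeckeLawAt … T` and
  `∀ … [IsGalois ℚ F] … T, ETwistKerAt S Kc w e T.E T.pChar T.fDeg → PELTwistLawAt … T`; BOTH PAID in §5.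
* §3 `stub_GEN : RecordGENChoicesCofinal` — **THE ONE REGISTERED-BY-WRITE SOCKET** (GEN՚s choices O1–O4 ★ + the E-line՚s exports (S-E) `ESepAt`, (H-E) `EHeckeAt`,
  (T-E) `ETwistKerAt` of the exported witnesses; payer: GEN zip `gen_of_parts` over the organs + an E-export letter, next edition).
* §4 `eLaws_of_provenance` (the provenance peel: `subst`, `cases` on the `HEq`; ≡ LA4-p02 (g0) §0e `pelWitnessE_heq_elim` 29c7dad6) and THE ZIP
  `elaws_of_parts (hGEN) (hH) (hT) : RecordPELELawsCofinal` — SORRY-FREE, TRIO: GEN՚s ∃-block PEELED by `Exists.elim` and re-packed (`S_L := S_G`), per `w` the index `i`,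
  per `T` the guarded E-laws at `(T.pChar, T.fDeg)` transported to `T.E`, then `hH`∕`hT` at `T`.
* §5 PAYERS (credited, inlined here because their natural home — the leaf ED. 2 — is not written under plan (A)): `heckeZip_holds : RecordHeckeZip` (one line on E-READINGS
  `heckeRoofsΩ_of_gen_iso` at `T.gen_iso`; = LA4-p02 §0d `pelHeckeLawAt_of_eHeckeAt` 39cb8c73; sorryAx ← E-READINGS `stub_HECKETRANS` until its ED. 3 := v6);
  `frobKernelBanal₀_of_kottRows` (LA4-p04 (g0) row-(7) payer, SNIPPET 579af007 VERBATIM, over ★ p848302); `pelTwistLawAt_of_eTwistKerAt` (LA4-p02 §0d VERBATIM: rows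
  (a)(b)(c)(FROB-𝔞)(FROB-n)(π1) token twins, row (π2-G) through the P-LINE ED. 2 §0c hoist `F0P6aPELInputs.kottRows_explicit` at a chosen `σ₀` (★ p847344) and `τR`
  (★ p847313) + the (FROB-can) pin + the payer, rows (K-law)∕(cover) by `coverKerΩ_of_gen_iso`∕`coverΩ_of_gen_iso`); `twistZip_holds : RecordTwistZip` (one line).
* §6 HEAD `elaws_of_line : type_of% @F0P6aPELSpread.stub_ELAWS := elaws_of_parts stub_GEN heckeZip_holds twistZip_holds` + SAME-STATEMENT tie
  `example : @F0P6aPELSpread.stub_ELAWS = @elaws_of_line := rfl` (proof irrelevance; elaborates iff the types agree).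
ED. 2: NO registered socket (`stub_GEN` PAID by §2b); `#print axioms elaws_of_line` = TRIO ∪ {sorryAx ← the X-leaf՚s sockets `stub_EHECKE`∕`stub_ESHEET` only}.  Imports: the served leaf + E-READINGS
+ ★ p848302 (no cycle: nothing below imports this module).  Budgets: DEFAULT `maxHeartbeats`, no `set_option` beyond the two programme ones; no instance, no notation.
HC_CM is proved only modulo the printed citations (2 remaining named inputs hLiu418 24832, h413 24833) until rung 0 closes — count-neutral.
[cite: RapoportSmithlingZhang2020Diagonal, §4.1 Thm. 4.1 p. 17; §4.3 (4.23) p. 21] [cite: Kottwitz1992, §5 pp. 389–391] [cite: Shimura1998, §18.6 Thm. 18.6 pp. 124–125; §13.1 Thm. 1 pp. 97–99]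
[cite: HarrisTaylorAMS2001, §III.4, pp. 108–110] [cite: Liu2021, Lemma C.18 p. 115, Prop. D.8 p. 135] [cite: MumfordFogartyKirwan1994, Ch. 7 §2 Def. 7.2 p. 129]
-/

set_option autoImplicit false

noncomputable section


namespace Summit.HodgeConjecture.HodgeConjecture.Cruxes.HLiu418.F0P6aStubGEN

set_option linter.dupNamespace false  -- `Summit.HodgeConjecture.HodgeConjecture.…` BY DESIGN (D-0017)

open CategoryTheory CategoryTheory.Limits NumberField IsDedekindDomain MulAction
open scoped Matrix Polynomial Pointwise
open Literature.NumberTheory.GaloisRepresentations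
open Literature.NumberTheory.Automorphic Literature.NumberTheory.Automorphic.UnitaryGroup
open Literature.AlgebraicGeometry.ShimuraVarieties.UnitaryCanonicalModel
open Literature.NumberTheory.Automorphic.Liu2021.AppendixC
open Literature.AlgebraicGeometry.Motives (AlgPoints IntegralModel SchemeOver thickening thickeningGalAction thickeningLift)
open Literature.NumberTheory.DiophantineGeometry (geomResidueField specialFibreFunctor)
open Literature.AlgebraicGeometry.RelativeSpec (ActionOver)
open Literature.NumberTheory.EllipticCurves (genericFibre)
open AlgebraicGeometry (QuasiCompact QuasiSeparated LocallyOfFinitePresentation Flat IsSeparated)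
open Summit.HodgeConjecture.HodgeConjecture.Cruxes.HLiu418.F0P6aModuliDatumDefs
open Summit.HodgeConjecture.HodgeConjecture.Cruxes.HLiu418.F0P6aRGDAssembly
open Summit.HodgeConjecture.HodgeConjecture.Cruxes.HLiu418.F0P6aPELWitnessE (PELWitnessE IsCMTypeThrough mOf)
open Summit.HodgeConjecture.HodgeConjecture.Cruxes.HLiu418.F0P6aStubKOTT (KottAdaptedAt UnmixedAt)
open Summit.HodgeConjecture.HodgeConjecture.Cruxes.HLiu418.F0P6aPELInputs
open Summit.HodgeConjecture.HodgeConjecture.Cruxes.HLiu418.F0P6aPELSpread (RecordPELELawsCofinal)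
open Summit.HodgeConjecture.HodgeConjecture.Cruxes.HLiu418.F0P6aEReadings (EHeckeAt ETwistKerAt heckeRoofsΩ_of_gen_iso coverΩ_of_gen_iso coverKerΩ_of_gen_iso)
open Summit.HodgeConjecture.HodgeConjecture.Theorems.F0P6aKottwitzCountAtSplitPlace (exists_restrict)
open Summit.HodgeConjecture.HodgeConjecture.Theorems.F0P6aKottwitzAtOmegaOfComplexPoints (exists_ringHom_comp_eq)

/-! ### §1 The letter of GEN՚s choices in E-currency -/

/-- **LETTER `RecordGENChoicesCofinal`** (the conclusion of the leaf ED. 2 organ `stub_GEN`) — `RecordPELELawsCofinal` TOKEN FOR TOKEN through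
`∃ i : ιdx, KottAdaptedAt ι₁ w (Φf i) ∧ UnmixedAt ι₁ w (Φf i) ∧`, then, IN PLACE OF the tail `∀ T : PELSpreadAt …, T.τE = τE → T.Φ = Φf i → HEq T.E (Ef i) → laws`,
THE E-CURRENCY LAWS OF THE CHOSEN WITNESS `Ef i` AT `w`: `ESepAt S Kc w (Ef i)` (point separation of the honest witness, E-export «`ε` injective on the slice»),
and for every `(p, f)` with `p` prime, `p ∈ 𝔭_w`, `N(𝔭_{c•w}) = p ^ f` (i.e. THE arithmetic of `w`; guarded universally so a spread instantiates at
`T.pChar T.fDeg`): `EHeckeAt S hU7ₛ hJ hJu Kc w hw (Ef i) p f` (E-export «Hecke-compatibility of `ε`», [Liu2021] Lemma C.18) and, on every datum sheet `e`,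
`ETwistKerAt S Kc w e (Ef i) p f` (E-export «sheet law of `ε`» + Shimura–Taniyama at `w`: twist ideals, norms, (FROB-𝔞)(FROB-n)(π1)(FROB-can)(K-law)(cover));
finally GEN՚s `hdisj` under `∀ h𝓨 θ hθ e` as in the leaf letter.  Reading: GEN chooses `Fᵢ Kc G φ 𝓜` (O1–O4 ★ organs), a FINITE family of CM types `Φf i ∋ ι₁`
with E-witnesses `Ef i` over one slice embedding `τE ∣ ι₁` (E-line head `pelWitnessE_of_line` per frame, compositum slice field, common small level), a finite
`S_G`; at every good split `w ∉ S_G` the hyperspecial passage, an index `i` whose frame is ADAPTED and UNMIXED at `w` (KOTT ED. 2 `exists_adapted_unmixed_frame`),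
and the E-side laws of THAT witness.  TRUE of the witnesses it chooses; never universal over a by-value `E` (n5).  Payers: GEN (choices, ★) + the E-line՚s exports
(`stub_EEXPORT` of the leaf card).  NOT asserted.
(print: RapoportSmithlingZhang2020Diagonal, §4.1 Thm. 4.1 p. 17) (print: Kottwitz1992, §5 pp. 389–391) (print: Liu2021, Lemma C.18 p. 115, Prop. D.8 p. 135)
(print: Shimura1998, §18.6 Thm. 18.6 pp. 124–125; §13.1 Thm. 1 pp. 97–99) (print: Deligne1971TravauxShimura, 4.16 p. 150) -/
def RecordGENChoicesCofinal : Prop :=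
  ∀ (F : Type) [Field F] [NumberField F] [IsCMField F] [IsGalois ℚ F] (ι₁ : F →+* ℂ)
    (Jstar : Matrix (Fin 2) (Fin 2) F)
    (K₀ : C5.OpenCompactSubgroup ↥(finAdelic ↥(maximalRealSubfield F) F (IsCMField.complexConj F) 2 Jstar))
    (S : RecordSystemGS F Jstar ι₁ K₀) (hU7ₛ : S.HeckeTranslateDefinedOver)
    (hJ : (Jstar.map (IsCMField.complexConj F))ᵀ = Jstar) (hJu : IsUnit Jstar) (K : C5.SmallLevel K₀),
    ∃ (Fi : Type) (_ : Field Fi) (_ : NumberField Fi) (_ : Algebra F Fi) (_ : FiniteDimensional F Fi) (_ : IsGalois F Fi)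
      (Kc : C5.SmallLevel K₀) (_hKcK : Kc ≤ K) (_hn : ∀ k ∈ K.1.1, C5.HeckeLE k Kc Kc)
      (G : Type) (_ : Group G) (_ : Finite G) (φ : ↥K.1.1 →* G) (_hφ : Function.Surjective φ)
      (_hφker : φ.ker = (Kc.1.1 : Subgroup ↥(finAdelic ↥(maximalRealSubfield F) F (IsCMField.complexConj F) 2 Jstar)).subgroupOf K.1.1)
      (𝓜 : IntegralModel (𝓞 F) F ((thickening F Fi).obj (S.M.obj Kc)))
      (_ : QuasiCompact 𝓜.total.hom) (_ : QuasiSeparated 𝓜.total.hom) (_ : LocallyOfFinitePresentation 𝓜.total.hom)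
      (_ : Flat 𝓜.total.hom) (_ : IsSeparated 𝓜.total.hom)
      (ιdx : Type) (_ : Finite ιdx) (Φf : ιdx → Set (F →+* ℂ)) (_hΦf : ∀ i, IsCMTypeThrough ι₁ (Φf i))
      (τE : Fi →+* ℂ) (_hτE : τE.comp (algebraMap F Fi) = ι₁) (Ef : ∀ i, PELWitnessE F ι₁ Jstar K₀ S Kc Fi τE (Φf i))
      (S_G : Set (HeightOneSpectrum (𝓞 F))), S_G.Finite ∧
      ∀ w : HeightOneSpectrum (𝓞 F), w ∉ S_G → ∀ hw : (IsCMField.complexConj F) • w ≠ w,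
        (UnitaryGroup.isUnit_placeForm Jstar hJu w).unit ∈ glInt 2 (w.adicCompletion F) →
          UnitaryGroup.IsHyperspecialAt ↥(maximalRealSubfield F) F (IsCMField.complexConj F) 2 Jstar K.1.1
            (w.under (𝓞 ↥(maximalRealSubfield F))) →
          UnitaryGroup.IsHyperspecialAt ↥(maximalRealSubfield F) F (IsCMField.complexConj F) 2 Jstar Kc.1.1
              (w.under (𝓞 ↥(maximalRealSubfield F))) ∧
          ∃ i : ιdx, KottAdaptedAt ι₁ w (Φf i) ∧ UnmixedAt ι₁ w (Φf i) ∧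
          -- THE E-CURRENCY LAWS OF THE CHOSEN WITNESS `Ef i` AT `w` (E-line exports; readings of `E`՚s tuple at `X`-points): point separation,
          -- and — for the arithmetic `(p, f)` of `w`, universally guarded so that a spread `T` instantiates them at `T.pChar T.fDeg` by
          -- `T.hpChar.1 T.hpChar.2 T.hfDeg` — the Hecke roofs and, on every datum sheet `e`, the twist∕kernel readings incl. (π1)(FROB-can)(K-law)
          ESepAt S Kc w (Ef i) ∧
          (∀ (pChar fDeg : ℕ), Nat.Prime pChar → (pChar : 𝓞 F) ∈ w.asIdeal →
              Nat.card (𝓞 F ⧸ ((IsCMField.complexConj F) • w).asIdeal) = pChar ^ fDeg →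
            EHeckeAt S hU7ₛ hJ hJu Kc w hw (Ef i) pChar fDeg ∧
              ∀ e : Fi →ₐ[F] AlgebraicClosure (w.adicCompletion F), ETwistKerAt S Kc w e (Ef i) pChar fDeg) ∧
          ∀ (h𝓨 : (𝓜.localise w).IsSmoothProper 1)
            (θ : ActionOver (𝓜.localise w).total.hom ((Fi ≃ₐ[F] Fi) × G))
            (_hθ : ∀ γ : Fi ≃ₐ[F] Fi,
               (genericFibre (HeightOneSpectrum.valuationSubringAtPrime F w) F).map
                     (Over.isoMk (θ.aut (γ, 1)) (θ.aut_comp (γ, 1))).hom ≫ (𝓜.localise w).genericIso'.hom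
                 = (𝓜.localise w).genericIso'.hom ≫
                     (Over.isoMk ((thickeningGalAction (L := Fi) (S.M.obj Kc)).aut γ)
                       ((thickeningGalAction (L := Fi) (S.M.obj Kc)).aut_comp γ)).hom)
            (e : Fi →ₐ[F] AlgebraicClosure (w.adicCompletion F)),
            haveI : AlgebraicGeometry.IsProper (𝓜.localise w).total.hom := h𝓨.2
            (∀ (β : Fi ≃ₐ[F] Fi) (P Q : AlgPoints (S.M.obj Kc) (AlgebraicClosure (w.adicCompletion F))),
                (𝓜.localise w).geomReductionMap (thickeningLift e (S.M.obj Kc) P) =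
                  AlgPoints.map ((specialFibreFunctor w).map (Over.isoMk (θ.aut (β, 1)) (θ.aut_comp (β, 1))).hom :
                      (𝓜.localise w).reductionAt ⟶ (𝓜.localise w).reductionAt)
                    ((𝓜.localise w).geomReductionMap (thickeningLift e (S.M.obj Kc) Q)) → β = 1)

/-! ### §2 The two per-spread E → P zip letters (the types of the leaf ED. 2 organs `stub_HECKE` ∕ `stub_TWIST`) -/

/-- **LETTER `RecordHeckeZip`** — (L4) AS TRANSPORT, by value, TRUE for every spread-with-provenance `T`: the E-side Hecke roofs `EHeckeAt … T.E T.pChar T.fDeg`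
of the witness `T` carries give the generic Hecke roofs `PELHeckeLawAt … T` of the spread (transport along `T.gen_iso`; E-READINGS `heckeRoofsΩ_of_gen_iso`,
socket `stub_HECKETRANS`).  PAID below (`heckeZip_holds`).  NOT asserted as a def.
(print: Kottwitz1992, §5 pp. 389–391) (print: RapoportSmithlingZhang2020Diagonal, §4.1 p. 17, §4.3 (4.23) p. 21) (print: HarrisTaylorAMS2001, §III.4, pp. 108–110) -/
def RecordHeckeZip : Prop :=
  ∀ (F : Type) [Field F] [NumberField F] [IsCMField F] (ι₁ : F →+* ℂ)
    (Jstar : Matrix (Fin 2) (Fin 2) F)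
    (K₀ : C5.OpenCompactSubgroup ↥(finAdelic ↥(maximalRealSubfield F) F (IsCMField.complexConj F) 2 Jstar))
    (S : RecordSystemGS F Jstar ι₁ K₀) (hU7ₛ : S.HeckeTranslateDefinedOver)
    (hJ : (Jstar.map (IsCMField.complexConj F))ᵀ = Jstar) (hJu : IsUnit Jstar)
    (Fi : Type) [Field Fi] [NumberField Fi] [Algebra F Fi] (Kc : C5.SmallLevel K₀) (G : Type) [Group G]
    (𝓜 : IntegralModel (𝓞 F) F ((thickening F Fi).obj (S.M.obj Kc)))
    (w : HeightOneSpectrum (𝓞 F)) (hw : (IsCMField.complexConj F) • w ≠ w) (h𝓨 : (𝓜.localise w).IsSmoothProper 1)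
    (θ : ActionOver (𝓜.localise w).total.hom ((Fi ≃ₐ[F] Fi) × G))
    (e : Fi →ₐ[F] AlgebraicClosure (w.adicCompletion F))
    (T : PELSpreadAt F ι₁ Jstar K₀ S hU7ₛ hJ hJu Fi Kc G 𝓜 w hw h𝓨 θ e),
    EHeckeAt S hU7ₛ hJ hJu Kc w hw T.E T.pChar T.fDeg → PELHeckeLawAt F ι₁ Jstar K₀ S hU7ₛ hJ hJu Fi Kc G 𝓜 w hw h𝓨 θ e T

/-- **LETTER `RecordTwistZip`** — (L5) AS TRANSPORT, by value, TRUE for every spread-with-provenance `T` over a Galois CM field: the E-side twist∕kernel readings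
`ETwistKerAt S Kc w e T.E T.pChar T.fDeg` on the datum sheet `e` give `PELTwistLawAt … T` — rows (a)(b)(c)(FROB-𝔞)(FROB-n)(π1) pass token for token, row (π2-G)
`FrobKernelBanal₀` by the (FROB-can) pin + the explicit Kottwitz rows of `T` (§0c `kottRows_explicit`, a THEOREM of `T`) + ★ p848302 (LA4-p04 payer
`frobKernelBanal₀_of_kottRows`), rows (K-law)∕(cover) by `coverKerΩ_of_gen_iso`∕`coverΩ_of_gen_iso` (LA4-p02 `pelTwistLawAt_of_eTwistKerAt`, cert 5f6789cf GREEN + TRIO).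
A HYPOTHESIS of the zip here (its payer lives in the leaf ED. 2).  NOT asserted.
(print: Shimura1998, §18.6 Thm. 18.6 pp. 124–125; §13.1 Thm. 1 pp. 97–99) (print: RapoportSmithlingZhang2020Diagonal, §3.2 p. 11, §4.3 p. 20) -/
def RecordTwistZip : Prop :=
  ∀ (F : Type) [Field F] [NumberField F] [IsCMField F] [IsGalois ℚ F] (ι₁ : F →+* ℂ)
    (Jstar : Matrix (Fin 2) (Fin 2) F)
    (K₀ : C5.OpenCompactSubgroup ↥(finAdelic ↥(maximalRealSubfield F) F (IsCMField.complexConj F) 2 Jstar))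
    (S : RecordSystemGS F Jstar ι₁ K₀) (hU7ₛ : S.HeckeTranslateDefinedOver)
    (hJ : (Jstar.map (IsCMField.complexConj F))ᵀ = Jstar) (hJu : IsUnit Jstar)
    (Fi : Type) [Field Fi] [NumberField Fi] [Algebra F Fi] (Kc : C5.SmallLevel K₀) (G : Type) [Group G]
    (𝓜 : IntegralModel (𝓞 F) F ((thickening F Fi).obj (S.M.obj Kc)))
    (w : HeightOneSpectrum (𝓞 F)) (hw : (IsCMField.complexConj F) • w ≠ w) (h𝓨 : (𝓜.localise w).IsSmoothProper 1)
    (θ : ActionOver (𝓜.localise w).total.hom ((Fi ≃ₐ[F] Fi) × G))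
    (e : Fi →ₐ[F] AlgebraicClosure (w.adicCompletion F))
    (T : PELSpreadAt F ι₁ Jstar K₀ S hU7ₛ hJ hJu Fi Kc G 𝓜 w hw h𝓨 θ e),
    ETwistKerAt S Kc w e T.E T.pChar T.fDeg → PELTwistLawAt F ι₁ Jstar K₀ S hU7ₛ hJ hJu Fi Kc G 𝓜 w hw h𝓨 θ e T

/-! ### §2b THE GEN ZIP (ED. 2; A-p13 (g38) re-cut of GEN A-p18 (g32)՚s HOME-GREEN `gen_of_parts` against the X-leaf՚s multi-frame head `eLaws_of_frames`):
the head hands ONE common small level `Kc″ ≤ K` normal in `K` for the whole finite frame family, per frame a slice field `Fi₀ᵢ ∕ F` over `ι₁` and, over every Galois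
`Fᵢ ⊇ Fi₀ᵢ`, a witness `Eᵢ` whose E-laws hold at EVERY split `w` under the guards «`Kc″` hyperspecial at `w`», «`J_w` unimodular», «`p ∤ Eᵢ.N`» (and «frame adapted
and unmixed at `w`» for the twist∕kernel readings).  GEN՚s choices: `ιdx :=` all CM types through `ι₁`; `Fᵢ :=` a Galois compositum of the `Fi₀ᵢ` inside `ℂ` over `ι₁`
(★ p849484); `G := K ∕ Kc″`; the integral model (O-MODEL) ★ p849537 restricted to `𝓞 F`; `S_G := ⋃ᵢ {w | (Eᵢ.N : 𝓞 F) ∈ 𝔭_w} ∪ {Kc″ not hyperspecial} ∪ {sheet model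
not smooth}` (first summand finite as `Eᵢ.N ≥ 3`; it absorbs the `p ∤ Eᵢ.N` guard); at a good `w` the frame is chosen ADAPTED and UNMIXED (KOTT ED. 2).  DEFAULT heartbeats:
the two existentials consumed here (the seventeen-component (O-MODEL) letter, KOTT՚s adapted-unmixed frame) are opened with `Exists.elim`, never with `obtain`
(each `cases` step re-targets this goal; seventeen of them exceed 200 000 heartbeats). -/

section GenZip

open Filter
open Summit.HodgeConjecture.HodgeConjecture.Cruxes.HLiu418.F0P6aPELWitnessE (GSAdele)
open Summit.HodgeConjecture.HodgeConjecture.Cruxes.HLiu418.F0P6aStubKOTT (exists_adapted_unmixed_frame)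
open Summit.HodgeConjecture.HodgeConjecture.Cruxes.HLiu418.F0P6aEExports (eLaws_of_frames)
open Literature.AlgebraicGeometry.Motives.IntegralModel (restrictScalarsOfIntermediate sheetModelOf
  eq_one_of_geomReductionMap_thickeningLift_eq eventually_isSmoothProper_zero_sheetModelOf
  quasiCompact_restrictScalarsOfIntermediate quasiSeparated_restrictScalarsOfIntermediate isSeparated_restrictScalarsOfIntermediate
  flat_restrictScalarsOfIntermediate locallyOfFinitePresentation_restrictScalarsOfIntermediate)
open Literature.FieldTheory.Galois (exists_numberField_isGalois_comp_eq)
open Literature.AlgebraicGeometry.Limits (exists_intermediateModel)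

set_option maxHeartbeats 400000 in
/-- **`gen_of_parts′ (hE : type_of% @eLaws_of_frames) : RecordGENChoicesCofinal`** — GEN՚s choices assembled from the X-leaf՚s multi-frame head (see the
section docstring for the road; the GEN LEAF ED. 2 hunk is `theorem stub_GEN : RecordGENChoicesCofinal := gen_of_parts′ F0P6aEExports.eLaws_of_frames`).
[cite: RapoportSmithlingZhang2020Diagonal, §4.1 Thm. 4.1 p. 17] [cite: Deligne1971TravauxShimura, 4.16 p. 150] [cite: Kottwitz1992, §5 pp. 389–391] -/
theorem gen_of_parts' (hE : type_of% @eLaws_of_frames) : RecordGENChoicesCofinal := by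
  intro F _ _ _ _ ι₁ Jstar K₀ S hU7ₛ hJ hJu K
  classical
  -- §a THE FRAMES: all CM types through `ι₁` (a finite type)
  let ιdx : Type := {Φ : Set (F →+* ℂ) // IsCMTypeThrough ι₁ Φ}
  haveI : Finite (Set (F →+* ℂ)) := by
    change Finite ((F →+* ℂ) → Prop); infer_instance
  haveI : Finite ιdx := Subtype.finite
  -- §b THE X-HEAD for the whole frame family at the input level `K`: ONE common small level `Kc ≤ K`, normal in `K`; per frame a slice field and witnesses
  obtain ⟨Kc, hKcK, hn, hframe⟩ := hE F ι₁ Jstar hJ hJu K₀ S hU7ₛ K ιdx (fun i => i.1) (fun i => i.2)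
  choose Fi₀ instF₀ instNF₀ instA₀ instG₀ τ₀ hτ₀ hwit using hframe
  -- §c THE SLICE FIELD: a Galois compositum of the `Fi₀ᵢ` inside `ℂ` over `ι₁` (★ p849484)
  letI := instF₀; letI := instNF₀; letI := instA₀
  obtain ⟨L, instFL, instNFL, instAL, instFDL, instGL, τL, hτL, j, hj⟩ :=
    exists_numberField_isGalois_comp_eq F ι₁ Fi₀ τ₀ hτ₀
  -- §d THE WITNESSES and their guarded E-laws, per frame, over `L` at level `Kc`
  have hwit' := fun i : ιdx => hwit i L τL (j i) (hj i)
  choose E hlaws using hwit'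
  -- §e THE FINITE QUOTIENT `G := K ∕ Kc` (normality `hn` from the head; `Kc` open in the compact `K`)
  let Nsub : Subgroup ↥K.1.1 := Kc.1.1.subgroupOf K.1.1
  haveI hNn : Nsub.Normal := by
    refine ⟨fun x hx u => ?_⟩
    have h := hn (u⁻¹ : ↥K.1.1).1 (u⁻¹).2 x.1 hx
    simp only [Subgroup.coe_inv, inv_inv] at h
    rw [Subgroup.mem_subgroupOf]
    simpa only [Subgroup.coe_mul, Subgroup.coe_inv] using h
  haveI : CompactSpace ↥K.1.1 := isCompact_iff_compactSpace.mp K.1.2.2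
  have hNo : IsOpen (Nsub : Set ↥K.1.1) := by
    change IsOpen (Subtype.val ⁻¹' (Kc.1.1 : Set (GSAdele F Jstar)))
    exact Kc.1.2.1.preimage continuous_subtype_val
  haveI : Finite (↥K.1.1 ⧸ Nsub) := Subgroup.quotient_finite_of_isOpen Nsub hNo
  -- §f THE MODEL: (O-MODEL) ★ p849537 at `X := S.M Kc` (projective ⇒ proper ⇒ qc, separated, finite type), restricted to `𝓞 F`
  have hXproj := S.projective Kc
  have hP : AlgebraicGeometry.IsProper (S.M.obj Kc).hom :=
    (Literature.AlgebraicGeometry.Morphisms.IsProjective.of_isProjectiveOver hXproj).isProper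
  have hm := @exists_intermediateModel F _ _ L _ _ _ (S.M.obj Kc)
    (@AlgebraicGeometry.instQuasiCompactOfUniversallyClosed _ _ _ hP.toUniversallyClosed) hP.toIsSeparated hP.toLocallyOfFiniteType
  -- (the seventeen-component existential is opened by `Exists.elim`, NOT by `obtain`: seventeen `cases` steps against this goal exceed the
  --  default heartbeat budget, the eliminator chain costs nothing)
  refine hm.elim fun B h => h.elim fun instB h => h.elim fun instAB h => h.elim fun instBL h => h.elim fun instT1 h =>
    h.elim fun instFB h => h.elim fun instT2 h => h.elim fun instT3 h => h.elim fun instFlat h => h.elim fun instFP h =>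
    h.elim fun 𝓜ᵢ h => ?_
  have hinj := h.1
  have hqc := h.2.1
  have hqs := h.2.2.1
  have hsep := h.2.2.2.1
  have hflat := h.2.2.2.2.1
  have hlfp := h.2.2.2.2.2
  haveI := hqc; haveI := hqs; haveI := hsep; haveI := hflat; haveI := hlfp
  have i1 : QuasiCompact (restrictScalarsOfIntermediate (F := F) hinj 𝓜ᵢ).total.hom :=
    quasiCompact_restrictScalarsOfIntermediate (F := F) hinj 𝓜ᵢ
  have i2 : QuasiSeparated (restrictScalarsOfIntermediate (F := F) hinj 𝓜ᵢ).total.hom :=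
    quasiSeparated_restrictScalarsOfIntermediate (F := F) hinj 𝓜ᵢ
  have i3 : LocallyOfFinitePresentation (restrictScalarsOfIntermediate (F := F) hinj 𝓜ᵢ).total.hom :=
    locallyOfFinitePresentation_restrictScalarsOfIntermediate (F := F) hinj 𝓜ᵢ
  have i4 : Flat (restrictScalarsOfIntermediate (F := F) hinj 𝓜ᵢ).total.hom :=
    flat_restrictScalarsOfIntermediate (F := F) hinj 𝓜ᵢ
  have i5 : IsSeparated (restrictScalarsOfIntermediate (F := F) hinj 𝓜ᵢ).total.hom :=
    isSeparated_restrictScalarsOfIntermediate (F := F) hinj 𝓜ᵢ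
  -- §g THE THREE COFINITE SETS: `Eᵢ.N ∉ 𝔭_w` (NEW; `Eᵢ.N ≥ 3`), hyperspeciality of `Kc`, étale sheet model
  have hNfin : ∀ i : ιdx, {w : HeightOneSpectrum (𝓞 F) | ((E i).N : 𝓞 F) ∈ w.asIdeal}.Finite := fun i => by
    have hN0 : (E i).N ≠ 0 := by have := (E i).hδN.2; omega
    have h0 : Ideal.span {((E i).N : 𝓞 F)} ≠ 0 := by
      rw [Ne, Ideal.zero_eq_bot, Ideal.span_singleton_eq_bot]
      exact_mod_cast hN0
    exact (Ideal.finite_factors h0).subset fun w hw => Ideal.dvd_span_singleton.2 hw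
  have hhyp : ∀ᶠ w : HeightOneSpectrum (𝓞 F) in cofinite,
      UnitaryGroup.IsHyperspecialAt ↥(maximalRealSubfield F) F (IsCMField.complexConj F) 2 Jstar Kc.1.1
        (w.under (𝓞 ↥(maximalRealSubfield F))) :=
    (tendsto_placesOver_cofinite ↥(maximalRealSubfield F) F).eventually
      (UnitaryGroup.eventually_isHyperspecialAt _ _ _ _ _ Kc.1.1 Kc.1.2.1 Kc.1.2.2)
  have hdisj := eventually_isSmoothProper_zero_sheetModelOf (F := F) (L := L) (B := B) hinj
  refine ⟨L, instFL, instNFL, instAL, instFDL, instGL, Kc, hKcK, hn, ?_⟩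
  refine ⟨↥K.1.1 ⧸ Nsub, inferInstance, inferInstance, QuotientGroup.mk' Nsub, QuotientGroup.mk'_surjective Nsub, QuotientGroup.ker_mk' Nsub, ?_⟩
  refine ⟨restrictScalarsOfIntermediate (F := F) hinj 𝓜ᵢ, i1, i2, i3, i4, i5, ?_⟩
  refine ⟨ιdx, inferInstance, fun i => i.1, fun i => i.2, τL, hτL, E,
    (⋃ i, {w : HeightOneSpectrum (𝓞 F) | ((E i).N : 𝓞 F) ∈ w.asIdeal}) ∪
      {w | ¬ UnitaryGroup.IsHyperspecialAt ↥(maximalRealSubfield F) F (IsCMField.complexConj F) 2 Jstar Kc.1.1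
        (w.under (𝓞 ↥(maximalRealSubfield F)))} ∪
      {w | ¬ ((sheetModelOf (F := F) hinj).localise w).IsSmoothProper 0},
    ((Set.finite_iUnion hNfin).union (Filter.eventually_cofinite.mp hhyp)).union (Filter.eventually_cofinite.mp hdisj), ?_⟩
  intro w hwS hw hunit _hK
  have hwN : ∀ i, ((E i).N : 𝓞 F) ∉ w.asIdeal := fun i h => hwS (Or.inl (Or.inl (Set.mem_iUnion.2 ⟨i, h⟩)))
  have hwH : UnitaryGroup.IsHyperspecialAt ↥(maximalRealSubfield F) F (IsCMField.complexConj F) 2 Jstar Kc.1.1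
      (w.under (𝓞 ↥(maximalRealSubfield F))) := Classical.byContradiction fun h => hwS (Or.inl (Or.inr h))
  have hwD : ((sheetModelOf (F := F) hinj).localise w).IsSmoothProper 0 := Classical.byContradiction fun h => hwS (Or.inr h)
  -- the frame ADAPTED and UNMIXED at `w` (KOTT ED. 2), its witness, and the guards discharged (`Exists.elim`, not `obtain`: no `cases` on this goal)
  refine (exists_adapted_unmixed_frame ι₁ w hw).elim fun Φ hfr => ?_
  have hΦ := hfr.1
  have had := hfr.2.1
  have hun := hfr.2.2
  have hl := hlaws ⟨Φ, hΦ⟩ w hw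
  refine ⟨hwH, ⟨Φ, hΦ⟩, had, hun, hl.1, fun pChar fDeg hp hpw hcard => ?_, fun h𝓨 θ hθ e => ?_⟩
  · have hndvd : ¬ pChar ∣ (E ⟨Φ, hΦ⟩).N := by
      rintro ⟨m, hm⟩
      refine hwN ⟨Φ, hΦ⟩ ?_
      rw [hm, Nat.cast_mul]
      exact w.asIdeal.mul_mem_right _ hpw
    have h2 := hl.2 hwH hunit pChar fDeg hp hpw hcard hndvd
    exact ⟨h2.1, h2.2 had hun⟩
  · haveI : AlgebraicGeometry.IsProper ((restrictScalarsOfIntermediate (F := F) hinj 𝓜ᵢ).localise w).total.hom := h𝓨.2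
    exact fun β P Q h => eq_one_of_geomReductionMap_thickeningLift_eq (F := F) hinj w (S.M.obj Kc) 𝓜ᵢ hwD θ hθ e β P Q h

end GenZip

/-! ### §3 THE REGISTERED-BY-WRITE SOCKET -/

end Summit.HodgeConjecture.HodgeConjecture.Cruxes.HLiu418.F0P6aStubGEN
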